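import Summits.AtomisticToContinuum.FouriersLaw.Theorems.LatticeLandauDampingAbelThermodynamicLimitOpenChainSeveredLocalityExcSet

/-!
# Open chain versus severed window: the fixed-scale `L²` estimate under the stationary law (engine of stub (M1sev))

Helper (`--supports stmt-AtomisticToContinuum-14013`) for the line `series-law-at-every-laplace-frequency`
(SketchIdeator2) of the crux `LatticeLandauDamping.AbelThermodynamicLimit`, stub (M1sev)
`stub_openChainSeveredLocality`. Registered sub-goal `pinnedChain_openChain_severed_estimate`.

Under the stationary law `μ_{N,T} ⊗ W` of the constructed Langevin flow `Φ_t(z, Bω)` of the open pinned anharmonic chain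
(both baths at `T`), the mean square of `j_k(Φ_t(z, Bω)) − j_k(T^Λ_t ι z)` — the central bond current along the strong
solution against the same current along LLL's severed flow of the window `Λ = [k-M, k+1+M]` started from the embedded
initial condition `ι z` — is at most `(cone term) + 4√(C₄ b)`: on the good event (weighted position box of the strong
solution on `[0, τ]`, exceptional probability `b_X`, `pinnedChain_weightedBox_exceptionalSet`; and the analogous box
for the severed flow, from the kinematics `q(s)² ≤ 2q(0)² + 2τ∫₀^τ p²` and the `N`-uniform time-integrated momentum tail
ALONG THE SEVERED FLOW, `pinnedChain_severedWindow_invariance`) the pathwise core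
`pinnedChain_openChain_severed_pathwise` makes the two currents `2^{-2M}`-close (polynomial Lipschitz bound of the
current, the surviving factor `(p_k + p_{k+1})²(T^Λ_t ι z)` has mean `≤ 4T` by invariance); off the good event the
fourth moments of both currents (both equal to `∫ j_k⁴ dμ_{N,T} ≤ C₄` by stationarity, resp. invariance) and Hölder.
Folklore; no definitions.
-/

noncomputable section

open MeasureTheory ProbabilityTheory Set Filter Topology
open scoped NNReal ENNReal BigOperators

namespace Summit.AtomisticToContinuum.FouriersLaw.Theorems.AbelThermodynamicLimit.SeriesLawAtEveryLaplaceFrequency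

open Literature.MathematicalPhysics.KineticTheory Literature.MathematicalPhysics.KineticTheory.HeatConduction
open Literature.Probability.Process OscillatorChain BulkWindow BoxTail
open Summit.AtomisticToContinuum.FouriersLaw.Theorems.NonBallistic
open Summit.AtomisticToContinuum.FouriersLaw.Theorems.PhononMeanFreePath (commonPastBound_gibbsEvenMoments)

namespace SeveredLocality

variable {N : ℕ} {ω₂ lam β γ : ℝ}

/-! ### The fixed-scale estimate -/

section Estimate

variable (hω : 0 < ω₂) (hl : 0 < lam) (hβ : 0 < β) (hγ : 0 < γ) {T : ℝ} (hT : 0 < T)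
  (hB1 : (pinnedChain ω₂ lam β γ).CondB1) (e : Fin N ≃ ↥(Finset.Icc (0 : ℤ) (0 + N - 1)))
  (he : ∀ k : Fin N, ((e k : ↥(Finset.Icc (0 : ℤ) (0 + N - 1))) : ℤ) = 0 + k) (η₀ : ChainConfig)

include hω hl hβ hγ hT he in
/-- **The fixed-scale `L²` estimate** (see the module docstring): with the window `Λ = [k-M, k+1+M]` (`M + 2 ≤ k`,
`k + M + 3 < N`), a scale `ρ ≥ 1` in the regime `2e√Θ τ ≤ 2M+1` (`Θ = ω₂ + 3 lam R² + 4(1+12βR²)`, `R² = 3ρ²√(3+M)`),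
an exceptional set `E` of the stationary law of measure `≤ b` off which the weighted position box of the strong solution
holds on `[0, τ]`, and `∫ j_k⁴ dμ_{N,T} ≤ C₄`: for every `t ∈ [0, τ]`, the mean square under `μ_{N,T} ⊗ W` of
`j_k(Φ_t(z,Bω)) − j_k(T^Λ_t ι z)` is at most
`(32(1+4β)² + 8T(1+12β)²) R⁸ Θ / 4^{2M+1} + 4√(C₄ (b + 4^{16}C_pτ^{32}·4/ρ^{32}))`. [folklore] -/
theorem severed_estimate (k : Fin N) {M : ℕ} (hk : M + 2 ≤ k.val) (hkN : k.val + M + 3 < N) {ρ τ : ℝ}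
    (hρ : 1 ≤ ρ) (hτ : 0 < τ)
    (hreg : 2 * Real.exp 1 * (Real.sqrt (ω₂ + 3 * lam * (3 * ρ ^ 2 * Real.sqrt (3 + (M : ℝ))) +
      4 * (1 + 12 * β * (3 * ρ ^ 2 * Real.sqrt (3 + (M : ℝ))))) * τ) ≤ 2 * M + 1)
    (E : Set (PhaseSpace N × WienerPair)) (hEm : MeasurableSet E) {b : ℝ} (hb : 0 ≤ b)
    (hEπ : (((pinnedChain ω₂ lam β γ).gibbsMeasure N T).prod wienerPair) E ≤ ENNReal.ofReal b)
    (hbox : ∀ q ∉ E, ∀ s ∈ Set.Icc (0:ℝ) τ, ∀ j j' : Fin N, (((j' : ℕ) : ℤ) - j).natAbs ≤ 1 →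
      ((pinnedChain ω₂ lam β γ).solMap N T T s q.1 (pairPath q.2)).1 j' ^ 2 ≤
        ρ ^ 2 * Real.sqrt (1 + ((((j : ℕ) : ℤ) - k).natAbs : ℝ)))
    {C₄ : ℝ} (hC₄ : 0 ≤ C₄)
    (hD2 : Integrable (fun x => (pinnedChain ω₂ lam β γ).bondCurrent N k x ^ 4) ((pinnedChain ω₂ lam β γ).gibbsMeasure N T) ∧
      ∫ x, (pinnedChain ω₂ lam β γ).bondCurrent N k x ^ 4 ∂((pinnedChain ω₂ lam β γ).gibbsMeasure N T) ≤ C₄)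
    {t : ℝ} (ht : t ∈ Set.Icc (0:ℝ) τ) :
    ∫⁻ z, ∫⁻ ω, ENNReal.ofReal
        (((pinnedChain ω₂ lam β γ).bondCurrent N k ((pinnedChain ω₂ lam β γ).solMap N T T t z (pairPath ω)) -
          (pinnedChain ω₂ lam β γ).bondCurrentZ
            (severedFlow hB1 (Finset.Icc ((k.val : ℤ) - M) ((k.val : ℤ) + 1 + M)) t
              (embed (Finset.Icc (0 : ℤ) (0 + N - 1)) e η₀ z)) (k.val : ℤ)) ^ 2)
        ∂wienerPair ∂((pinnedChain ω₂ lam β γ).gibbsMeasure N T) ≤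
      ENNReal.ofReal ((32 * (1 + 4 * β) ^ 2 + 8 * T * (1 + 12 * β) ^ 2) * (3 * ρ ^ 2 * Real.sqrt (3 + (M : ℝ))) ^ 4 *
          (ω₂ + 3 * lam * (3 * ρ ^ 2 * Real.sqrt (3 + (M : ℝ))) +
            4 * (1 + 12 * β * (3 * ρ ^ 2 * Real.sqrt (3 + (M : ℝ))))) / 4 ^ (2 * M + 1)) +
        ENNReal.ofReal (4 * Real.sqrt (C₄ * (b +
          4 ^ 16 * (T ^ 16 * ∏ j ∈ Finset.range 16, (2 * (j : ℝ) + 1)) * τ ^ 32 / ρ ^ 32 * 4))) := by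
  -- adapted from `SingleFlip.single_flip_weighted` (two strong solutions there; strong solution vs severed flow here)
  set P := pinnedChain ω₂ lam β γ with hP
  set μ := P.gibbsMeasure N T with hμ
  haveI hμP : IsProbabilityMeasure μ := pinnedChain_isProbabilityMeasure_gibbsMeasure hω hl.le hβ.le γ N hT
  have hN0 : 0 < N := by omega
  have hk1 : k.val + 1 < N := by omega
  set k1 : Fin N := ⟨k.val + 1, hk1⟩ with hk1def
  have hk1z : (((k1 : Fin N) : ℕ) : ℤ) = (k.val : ℤ) + 1 := by rw [hk1def]; push_cast; ring
  set Λ : Finset ℤ := Finset.Icc ((k.val : ℤ) - M) ((k.val : ℤ) + 1 + M) with hΛ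
  set ι := embed (Finset.Icc (0 : ℤ) (0 + N - 1)) e η₀ with hι
  have hΛb : bondSet Λ ⊆ Finset.Icc (0 : ℤ) (0 + N - 2) := bondSet_window_subset k hk hkN
  have hιapp : ∀ (z : PhaseSpace N) (l : Fin N), ι z ((l : ℕ) : ℤ) = (z.1 l, z.2 l) :=
    embed_Icc_zero_apply e he η₀
  -- the scales (opaque abbreviations)
  obtain ⟨R2, hR2⟩ : ∃ R2 : ℝ, R2 = 3 * ρ ^ 2 * Real.sqrt (3 + (M : ℝ)) := ⟨_, rfl⟩
  rw [← hR2] at hreg ⊢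
  have hρ0 : 0 < ρ := lt_of_lt_of_le one_pos hρ
  have hsM : 1 ≤ Real.sqrt (3 + (M : ℝ)) := by
    rw [show (1:ℝ) = Real.sqrt 1 from Real.sqrt_one.symm]; exact Real.sqrt_le_sqrt (by linarith [M.cast_nonneg (α := ℝ)])
  have hR21 : 1 ≤ R2 := by
    rw [hR2]; exact one_le_mul_of_one_le_of_one_le (by linarith [one_le_pow₀ (n := 2) hρ]) hsM
  have hR20 : 0 ≤ R2 := zero_le_one.trans hR21
  obtain ⟨R, hR⟩ : ∃ R : ℝ, R = Real.sqrt R2 := ⟨_, rfl⟩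
  have hRR : R ^ 2 = R2 := by rw [hR]; exact Real.sq_sqrt hR20
  obtain ⟨Θ, hΘ⟩ : ∃ Θ : ℝ, Θ = ω₂ + 3 * lam * R2 + 4 * (1 + 12 * β * R2) := ⟨_, rfl⟩
  rw [← hΘ] at hreg ⊢
  have hΘ1 : 1 ≤ Θ := by
    have h1 : 0 ≤ 3 * lam * R2 := by positivity
    have h2 : 0 ≤ 12 * β * R2 := by positivity
    rw [hΘ]; linarith [hω.le]
  have hΘ0 : 0 ≤ Θ := zero_le_one.trans hΘ1
  set δq : ℝ := 2 * R * (1 / 2) ^ (2 * M + 2) with hδq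
  set δp : ℝ := 2 * R * Real.sqrt Θ * (1 / 2) ^ (2 * M + 1) with hδp
  set A₁ : ℝ := 2 * (2 * R + 8 * β * R ^ 3) ^ 2 * δp ^ 2 with hA₁
  set A₂ : ℝ := 2 * (1 + 12 * β * R ^ 2) ^ 2 * δq ^ 2 with hA₂
  have hA₁0 : 0 ≤ A₁ := by positivity
  have hA₂0 : 0 ≤ A₂ := by positivity
  -- measurability
  have hzm : Measurable fun q : PhaseSpace N × WienerPair => P.solMap N T T t q.1 (pairPath q.2) :=
    pinnedChain_measurable_solMap_pairPath hω hl.le hβ.le hγ.le N T T t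
  have hYm : ∀ r, Measurable fun z : PhaseSpace N => severedFlow hB1 Λ r (ι z) := fun r =>
    measurable_severedFlow_embed γ hB1 e Λ η₀ r
  have hjm : Measurable (P.bondCurrent N k) := (pinnedChain_continuous_bondCurrent ω₂ lam β γ N k).measurable
  set J : PhaseSpace N × WienerPair → ℝ := fun q => P.bondCurrent N k (P.solMap N T T t q.1 (pairPath q.2)) with hJ
  set J' : PhaseSpace N × WienerPair → ℝ := fun q => P.bondCurrentZ (severedFlow hB1 Λ t (ι q.1)) (k.val : ℤ) with hJ'
  have hJm : Measurable J := by have h := hjm.comp hzm; exact h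
  have hJ'zm : Measurable fun z : PhaseSpace N => P.bondCurrentZ (severedFlow hB1 Λ t (ι z)) (k.val : ℤ) := by
    have h := (measurable_bondCurrentZ P (k.val : ℤ)).comp (hYm t); exact h
  have hJ'm : Measurable J' := by
    have h := hJ'zm.comp (measurable_fst : Measurable (Prod.fst : PhaseSpace N × WienerPair → PhaseSpace N)); exact h
  -- the bad event
  obtain ⟨hEYm, hEYμ⟩ := severed_excSet (γ := γ) hω hl.le hβ.le hT hB1 e he η₀ k hk hkN hρ hτ
  rw [← hΛ, ← hι] at hEYm hEYμ
  set bY : ℝ := 4 ^ 16 * (T ^ 16 * ∏ j ∈ Finset.range 16, (2 * (j : ℝ) + 1)) * τ ^ 32 / ρ ^ 32 * 4 with hbY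
  have hbY0 : 0 ≤ bY := by
    have : 0 ≤ ∏ j ∈ Finset.range 16, (2 * (j : ℝ) + 1) := Finset.prod_nonneg fun j _ => by positivity
    rw [hbY]; positivity
  set EY : Set (PhaseSpace N) := {z : PhaseSpace N | ∃ l : Fin N,
      ρ ^ 2 * Real.sqrt (1 + ((((l : ℕ) : ℤ) - k).natAbs : ℝ)) / (4 * τ) <
        ∫ r in (0:ℝ)..τ, (severedFlow hB1 Λ r (ι z) ((l : ℕ) : ℤ)).2 ^ 2} with hEY
  set BAD : Set (PhaseSpace N × WienerPair) := E ∪ Prod.fst ⁻¹' EY with hBAD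
  have hBADm : MeasurableSet BAD := hEm.union (measurable_fst hEYm)
  set W : PhaseSpace N → ℝ := fun z =>
    ((severedFlow hB1 Λ t (ι z) (k.val : ℤ)).2 + (severedFlow hB1 Λ t (ι z) ((k.val : ℤ) + 1)).2) ^ 2 with hW
  have hWm : Measurable W := by
    have h1 : Measurable fun z : PhaseSpace N => (severedFlow hB1 Λ t (ι z) (k.val : ℤ)).2 :=
      measurable_snd.comp ((measurable_pi_apply _).comp (hYm t))
    have h2 : Measurable fun z : PhaseSpace N => (severedFlow hB1 Λ t (ι z) ((k.val : ℤ) + 1)).2 :=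
      measurable_snd.comp ((measurable_pi_apply _).comp (hYm t))
    exact (h1.add h2).pow_const 2
  set F : PhaseSpace N × WienerPair → ℝ≥0∞ := fun q => ENNReal.ofReal ((J q - J' q) ^ 2) with hF
  set G₁ : PhaseSpace N × WienerPair → ℝ≥0∞ := fun q => ENNReal.ofReal A₁ + ENNReal.ofReal (A₂ * W q.1) with hG₁
  set G₂ : PhaseSpace N × WienerPair → ℝ≥0∞ := fun q =>
    2 * (BAD.indicator (fun _ => (1 : ℝ≥0∞)) q * ENNReal.ofReal (J' q ^ 2)) +
      2 * (BAD.indicator (fun _ => (1 : ℝ≥0∞)) q * ENNReal.ofReal (J q ^ 2)) with hG₂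
  have hG₁m : Measurable G₁ :=
    measurable_const.add (ENNReal.measurable_ofReal.comp (measurable_const.mul (hWm.comp measurable_fst)))
  have hindm : Measurable (BAD.indicator fun _ => (1 : ℝ≥0∞)) := measurable_const.indicator hBADm
  -- two elementary inequalities
  have sq_sub_le : ∀ a c : ℝ, (a - c) ^ 2 ≤ 2 * c ^ 2 + 2 * a ^ 2 := fun a c => by
    linarith [sq_nonneg (a + c), show 2 * c ^ 2 + 2 * a ^ 2 - (a - c) ^ 2 = (a + c) ^ 2 by ring]
  have sq_add_le : ∀ a c : ℝ, (a + c) ^ 2 ≤ 2 * a ^ 2 + 2 * c ^ 2 := fun a c => by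
    linarith [sq_nonneg (a - c), show 2 * a ^ 2 + 2 * c ^ 2 - (a + c) ^ 2 = (a - c) ^ 2 by ring]
  -- Step 1: pointwise domination `F ≤ G₁ + G₂`
  have hdom : ∀ q, F q ≤ G₁ q + G₂ q := by
    rintro ⟨z, ω⟩
    by_cases hq : (z, ω) ∈ BAD
    · have h1 : F (z, ω) ≤ G₂ (z, ω) := by
        simp only [hF, hG₂, Set.indicator_of_mem hq, one_mul]
        have e : (J (z, ω) - J' (z, ω)) ^ 2 ≤ 2 * J' (z, ω) ^ 2 + 2 * J (z, ω) ^ 2 := sq_sub_le _ _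
        calc ENNReal.ofReal ((J (z, ω) - J' (z, ω)) ^ 2)
            ≤ ENNReal.ofReal (2 * J' (z, ω) ^ 2 + 2 * J (z, ω) ^ 2) := ENNReal.ofReal_le_ofReal e
          _ = 2 * ENNReal.ofReal (J' (z, ω) ^ 2) + 2 * ENNReal.ofReal (J (z, ω) ^ 2) := by
              rw [ENNReal.ofReal_add (by positivity) (by positivity), ENNReal.ofReal_mul (by norm_num),
                ENNReal.ofReal_mul (by norm_num), ENNReal.ofReal_ofNat]
      exact h1.trans le_add_self
    · have hzE : (z, ω) ∉ E := fun h => hq (Or.inl h)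
      have hzY : z ∉ EY := fun h => hq (Or.inr h)
      have hXq : ∀ s ∈ Set.Icc (0:ℝ) τ, ∀ l : Fin N,
          (P.solMap N T T s z (pairPath ω)).1 l ^ 2 ≤ ρ ^ 2 * Real.sqrt (1 + ((((l : ℕ) : ℤ) - k).natAbs : ℝ)) :=
        fun s hs l => hbox (z, ω) hzE s hs l l (by simp)
      have hYint : ∀ l : Fin N, ∫ r in (0:ℝ)..τ, (severedFlow hB1 Λ r (ι z) ((l : ℕ) : ℤ)).2 ^ 2 ≤
          ρ ^ 2 * Real.sqrt (1 + ((((l : ℕ) : ℤ) - k).natAbs : ℝ)) / (4 * τ) := fun l => by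
        by_contra hcon; exact hzY ⟨l, not_le.1 hcon⟩
      have hpw := pathwise_current_sq_le hB1 e he η₀ hω hl.le hβ.le hγ.le T k hk hkN hτ hR2 hR hΘ hreg z (pairPath ω)
        ht hXq hYint
      rw [← hΛ, ← hι] at hpw
      have hreal : (J (z, ω) - J' (z, ω)) ^ 2 ≤ A₁ + A₂ * W z := by
        simp only [hJ, hJ', hA₁, hA₂, hW, hδp, hδq]
        exact hpw
      have h1 : F (z, ω) ≤ G₁ (z, ω) := by
        simp only [hF, hG₁]
        calc ENNReal.ofReal ((J (z, ω) - J' (z, ω)) ^ 2) ≤ ENNReal.ofReal (A₁ + A₂ * W z) := ENNReal.ofReal_le_ofReal hreal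
          _ ≤ ENNReal.ofReal A₁ + ENNReal.ofReal (A₂ * W z) := ENNReal.ofReal_add_le
      exact h1.trans le_self_add
  -- Step 2: integrate
  set π : Measure (PhaseSpace N × WienerPair) := μ.prod wienerPair with hπ
  haveI hπP : IsProbabilityMeasure π := by rw [hπ]; infer_instance
  have hFm : Measurable F := ENNReal.measurable_ofReal.comp ((hJm.sub hJ'm).pow_const 2)
  have hsplit : ∫⁻ z, ∫⁻ ω, F (z, ω) ∂wienerPair ∂μ ≤ ∫⁻ q, G₁ q ∂π + ∫⁻ q, G₂ q ∂π := by
    calc ∫⁻ z, ∫⁻ ω, F (z, ω) ∂wienerPair ∂μ = ∫⁻ q, F q ∂π := (lintegral_prod F hFm.aemeasurable).symm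
      _ ≤ ∫⁻ q, (G₁ q + G₂ q) ∂π := lintegral_mono hdom
      _ = ∫⁻ q, G₁ q ∂π + ∫⁻ q, G₂ q ∂π := lintegral_add_left hG₁m _
  -- Step 3: the good term
  have hfst : ∀ {G : PhaseSpace N → ℝ≥0∞}, Measurable G → ∫⁻ q, G q.1 ∂π = ∫⁻ z, G z ∂μ := by
    intro G hG
    rw [← lintegral_map hG measurable_fst, hπ, Measure.map_fst_prod, measure_univ, one_smul]
  have hWint : ∫⁻ z, ENNReal.ofReal (W z) ∂μ ≤ ENNReal.ofReal (4 * T) := by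
    have hFσ : Measurable fun σ : ChainConfig => ENNReal.ofReal (((σ (k.val : ℤ)).2 + (σ ((k.val : ℤ) + 1)).2) ^ 2) :=
      (((measurable_snd.comp (measurable_pi_apply _)).add
        (measurable_snd.comp (measurable_pi_apply _))).pow_const 2).ennreal_ofReal
    have hinv := lintegral_comp_severedFlow_embed γ hω hl.le hβ.le hT hB1 e he η₀ hΛb t hFσ
    rw [← hι] at hinv
    have e1 : ∀ z : PhaseSpace N, ((ι z (k.val : ℤ)).2 + (ι z ((k.val : ℤ) + 1)).2) ^ 2 = (z.2 k + z.2 k1) ^ 2 := by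
      intro z
      rw [show (k.val : ℤ) = (((k : Fin N) : ℕ) : ℤ) from rfl, hιapp, ← hk1z, hιapp]
    obtain ⟨hi2k, hv2k⟩ := commonPastBound_gibbsEvenMoments ω₂ lam β γ hω hl.le hβ.le T hT N k 1
    obtain ⟨hi2k1, hv2k1⟩ := commonPastBound_gibbsEvenMoments ω₂ lam β γ hω hl.le hβ.le T hT N k1 1
    simp only [Finset.range_one, Finset.prod_singleton, Nat.cast_zero, mul_zero, zero_add, mul_one, pow_one] at hv2k hv2k1 hi2k hi2k1
    have hsum : Integrable (fun z : PhaseSpace N => 2 * z.2 k ^ 2 + 2 * z.2 k1 ^ 2) μ :=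
      (hi2k.const_mul 2).add (hi2k1.const_mul 2)
    calc ∫⁻ z, ENNReal.ofReal (W z) ∂μ
        = ∫⁻ z, ENNReal.ofReal (((severedFlow hB1 Λ t (ι z) (k.val : ℤ)).2 +
            (severedFlow hB1 Λ t (ι z) ((k.val : ℤ) + 1)).2) ^ 2) ∂μ := rfl
      _ = ∫⁻ z, ENNReal.ofReal (((ι z (k.val : ℤ)).2 + (ι z ((k.val : ℤ) + 1)).2) ^ 2) ∂μ := hinv
      _ = ∫⁻ z, ENNReal.ofReal ((z.2 k + z.2 k1) ^ 2) ∂μ := lintegral_congr fun z => by rw [e1 z]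
      _ ≤ ∫⁻ z, ENNReal.ofReal (2 * z.2 k ^ 2 + 2 * z.2 k1 ^ 2) ∂μ :=
          lintegral_mono fun z => ENNReal.ofReal_le_ofReal (sq_add_le _ _)
      _ = ENNReal.ofReal (∫ z, (2 * z.2 k ^ 2 + 2 * z.2 k1 ^ 2) ∂μ) :=
          (ofReal_integral_eq_lintegral_ofReal hsum (ae_of_all _ fun z => by positivity)).symm
      _ = ENNReal.ofReal (4 * T) := by
          rw [integral_add (hi2k.const_mul 2) (hi2k1.const_mul 2), integral_const_mul, integral_const_mul, hv2k, hv2k1]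
          ring_nf
  have hT1 : ∫⁻ q, G₁ q ∂π ≤ ENNReal.ofReal (A₁ + A₂ * (4 * T)) := by
    have hm2 : Measurable fun z : PhaseSpace N => ENNReal.ofReal (A₂ * W z) :=
      ENNReal.measurable_ofReal.comp (measurable_const.mul hWm)
    calc ∫⁻ q, G₁ q ∂π = ∫⁻ q, ENNReal.ofReal A₁ ∂π + ∫⁻ q, ENNReal.ofReal (A₂ * W q.1) ∂π :=
          lintegral_add_left measurable_const _
      _ = ENNReal.ofReal A₁ + ENNReal.ofReal A₂ * ∫⁻ z, ENNReal.ofReal (W z) ∂μ := by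
          rw [lintegral_const, measure_univ, mul_one, hfst hm2]
          congr 1
          rw [← lintegral_const_mul' _ _ ENNReal.ofReal_ne_top]
          exact lintegral_congr fun z => ENNReal.ofReal_mul hA₂0
      _ ≤ ENNReal.ofReal A₁ + ENNReal.ofReal A₂ * ENNReal.ofReal (4 * T) := add_le_add le_rfl (mul_le_mul' le_rfl hWint)
      _ = ENNReal.ofReal (A₁ + A₂ * (4 * T)) := by
          rw [← ENNReal.ofReal_mul hA₂0, ← ENNReal.ofReal_add hA₁0 (by positivity)]
  -- Step 4: the bad term
  have hπBAD : π BAD ≤ ENNReal.ofReal (b + bY) := by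
    calc π BAD ≤ π E + π (Prod.fst ⁻¹' EY) := measure_union_le _ _
      _ = π E + μ EY := by
          rw [← Measure.map_apply measurable_fst hEYm, hπ, Measure.map_fst_prod, measure_univ, one_smul]
      _ ≤ ENNReal.ofReal b + ENNReal.ofReal bY := add_le_add hEπ hEYμ
      _ = ENNReal.ofReal (b + bY) := (ENNReal.ofReal_add hb hbY0).symm
  have e4 : ∀ r : ℝ, ENNReal.ofReal (r ^ 2) ^ 2 = ENNReal.ofReal (r ^ 4) := by
    intro r; rw [← ENNReal.ofReal_pow (sq_nonneg _)]; ring_nf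
  have h4J : ∫⁻ q, ENNReal.ofReal (J q ^ 2) ^ 2 ∂π ≤ ENNReal.ofReal C₄ := by
    have h := (FSAssembly.lintegral_current_four_le hω hl hβ hγ hT hN0 k k hD2 t.toNNReal).1
    have et : ((t.toNNReal : ℝ≥0) : ℝ) = t := Real.coe_toNNReal t ht.1
    simpa only [et] using h
  have h4J' : ∫⁻ q, ENNReal.ofReal (J' q ^ 2) ^ 2 ∂π ≤ ENNReal.ofReal C₄ := by
    simp_rw [e4]
    have hFσ : Measurable fun σ : ChainConfig => ENNReal.ofReal (P.bondCurrentZ σ (k.val : ℤ) ^ 4) :=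
      ((measurable_bondCurrentZ P _).pow_const 4).ennreal_ofReal
    have hinv4 := lintegral_comp_severedFlow_embed γ hω hl.le hβ.le hT hB1 e he η₀ hΛb t hFσ
    rw [← hι] at hinv4
    rw [hfst (G := fun z => ENNReal.ofReal (P.bondCurrentZ (severedFlow hB1 Λ t (ι z)) (k.val : ℤ) ^ 4))
      ((hJ'zm.pow_const 4).ennreal_ofReal), hinv4]
    have hb : ∀ z : PhaseSpace N, P.bondCurrentZ (ι z) (k.val : ℤ) = P.bondCurrent N k z :=
      fun z => bondCurrentZ_embed e he η₀ k hk1 z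
    simp only [hb]
    rw [← ofReal_integral_eq_lintegral_ofReal hD2.1 (ae_of_all _ fun z => by positivity)]
    exact ENNReal.ofReal_le_ofReal hD2.2
  have hT2 : ∫⁻ q, G₂ q ∂π ≤ ENNReal.ofReal (4 * Real.sqrt (C₄ * (b + bY))) := by
    have hm1 : Measurable fun q => BAD.indicator (fun _ => (1 : ℝ≥0∞)) q * ENNReal.ofReal (J' q ^ 2) :=
      hindm.mul (ENNReal.measurable_ofReal.comp (hJ'm.pow_const 2))
    have hm2 : Measurable fun q => BAD.indicator (fun _ => (1 : ℝ≥0∞)) q * ENNReal.ofReal (J q ^ 2) :=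
      hindm.mul (ENNReal.measurable_ofReal.comp (hJm.pow_const 2))
    have hbb : 0 ≤ b + bY := by positivity
    have hH1 := FSAssembly.lintegral_indicator_sq_le_sqrt π hJ'm hBADm hC₄ hbb h4J' hπBAD
    have hH2 := FSAssembly.lintegral_indicator_sq_le_sqrt π hJm hBADm hC₄ hbb h4J hπBAD
    calc ∫⁻ q, G₂ q ∂π = 2 * ∫⁻ q, BAD.indicator (fun _ => (1 : ℝ≥0∞)) q * ENNReal.ofReal (J' q ^ 2) ∂π +
          2 * ∫⁻ q, BAD.indicator (fun _ => (1 : ℝ≥0∞)) q * ENNReal.ofReal (J q ^ 2) ∂π := by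
          simp only [hG₂]
          rw [lintegral_add_left (hm1.const_mul 2), lintegral_const_mul 2 hm1, lintegral_const_mul 2 hm2]
      _ ≤ 2 * ENNReal.ofReal (Real.sqrt (C₄ * (b + bY))) + 2 * ENNReal.ofReal (Real.sqrt (C₄ * (b + bY))) :=
          add_le_add (mul_le_mul' le_rfl hH1) (mul_le_mul' le_rfl hH2)
      _ = ENNReal.ofReal (4 * Real.sqrt (C₄ * (b + bY))) := by
          rw [← two_mul, ← mul_assoc, ← ENNReal.ofReal_ofNat 2, ← ENNReal.ofReal_mul (by norm_num),
            ← ENNReal.ofReal_mul (by norm_num)]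
          congr 1; ring
  -- Step 5: the cone constant
  have hcone : A₁ + A₂ * (4 * T) ≤
      (32 * (1 + 4 * β) ^ 2 + 8 * T * (1 + 12 * β) ^ 2) * R2 ^ 4 * Θ / 4 ^ (2 * M + 1) := by
    set x : ℝ := (1 / 2) ^ (2 * M + 1) with hx
    have hΘs : Real.sqrt Θ ^ 2 = Θ := Real.sq_sqrt hΘ0
    have hx2 : x ^ 2 = 1 / 4 ^ (2 * M + 1) := by
      rw [hx, ← pow_mul, mul_comm, pow_mul, one_div_pow, one_div_pow]; norm_num
    have hq' : (1 / 2 : ℝ) ^ (2 * M + 2) = x * (1 / 2) := by rw [hx, ← pow_succ]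
    have hδp2 : δp ^ 2 = 4 * R2 * Θ * x ^ 2 := by
      calc δp ^ 2 = 4 * R ^ 2 * Real.sqrt Θ ^ 2 * x ^ 2 := by rw [hδp]; ring
        _ = 4 * R2 * Θ * x ^ 2 := by rw [hΘs, hRR]
    have hδq2 : δq ^ 2 = R2 * x ^ 2 := by
      calc δq ^ 2 = R ^ 2 * x ^ 2 := by rw [hδq, hq']; ring
        _ = R2 * x ^ 2 := by rw [hRR]
    have hR3 : (2 * R + 8 * β * R ^ 3) ^ 2 = 4 * R2 * (1 + 4 * β * R2) ^ 2 := by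
      calc (2 * R + 8 * β * R ^ 3) ^ 2 = 4 * R ^ 2 * (1 + 4 * β * R ^ 2) ^ 2 := by ring
        _ = _ := by rw [hRR]
    have hA₁e : A₁ = 32 * R2 ^ 2 * Θ * (1 + 4 * β * R2) ^ 2 * x ^ 2 := by rw [hA₁, hR3, hδp2]; ring
    have hA₂e : A₂ * (4 * T) = 8 * T * R2 * (1 + 12 * β * R2) ^ 2 * x ^ 2 := by rw [hA₂, hRR, hδq2]; ring
    have h14 : (1 + 4 * β * R2) ^ 2 ≤ (1 + 4 * β) ^ 2 * R2 ^ 2 := by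
      have e : (1 + 4 * β) * R2 = R2 + 4 * β * R2 := by ring
      rw [← mul_pow]; exact pow_le_pow_left₀ (by positivity) (by rw [e]; linarith) 2
    have h112 : (1 + 12 * β * R2) ^ 2 ≤ (1 + 12 * β) ^ 2 * R2 ^ 2 := by
      have e : (1 + 12 * β) * R2 = R2 + 12 * β * R2 := by ring
      rw [← mul_pow]; exact pow_le_pow_left₀ (by positivity) (by rw [e]; linarith) 2
    have hR34 : R2 ^ 3 ≤ R2 ^ 4 * Θ :=
      calc R2 ^ 3 = R2 ^ 3 * 1 := by ring
        _ ≤ R2 ^ 3 * (R2 * Θ) := mul_le_mul_of_nonneg_left (one_le_mul_of_one_le_of_one_le hR21 hΘ1) (by positivity)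
        _ = R2 ^ 4 * Θ := by ring
    have e1 := mul_le_mul_of_nonneg_left h14 (show 0 ≤ 32 * R2 ^ 2 * Θ by positivity)
    have e2 := mul_le_mul_of_nonneg_left h112 (show 0 ≤ 8 * T * R2 by positivity)
    have e3 := mul_le_mul_of_nonneg_left hR34 (show 0 ≤ 8 * T * (1 + 12 * β) ^ 2 by positivity)
    have key : 32 * R2 ^ 2 * Θ * (1 + 4 * β * R2) ^ 2 + 8 * T * R2 * (1 + 12 * β * R2) ^ 2 ≤
        (32 * (1 + 4 * β) ^ 2 + 8 * T * (1 + 12 * β) ^ 2) * R2 ^ 4 * Θ :=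
      calc _ ≤ 32 * R2 ^ 2 * Θ * ((1 + 4 * β) ^ 2 * R2 ^ 2) + 8 * T * R2 * ((1 + 12 * β) ^ 2 * R2 ^ 2) :=
            add_le_add e1 e2
        _ = 32 * (1 + 4 * β) ^ 2 * R2 ^ 4 * Θ + 8 * T * (1 + 12 * β) ^ 2 * R2 ^ 3 := by ring
        _ ≤ 32 * (1 + 4 * β) ^ 2 * R2 ^ 4 * Θ + 8 * T * (1 + 12 * β) ^ 2 * (R2 ^ 4 * Θ) :=
            add_le_add le_rfl e3
        _ = _ := by ring
    have hfin := mul_le_mul_of_nonneg_right key (sq_nonneg x)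
    calc A₁ + A₂ * (4 * T)
        = (32 * R2 ^ 2 * Θ * (1 + 4 * β * R2) ^ 2 + 8 * T * R2 * (1 + 12 * β * R2) ^ 2) * x ^ 2 := by
          rw [hA₁e, hA₂e]; ring
      _ ≤ (32 * (1 + 4 * β) ^ 2 + 8 * T * (1 + 12 * β) ^ 2) * R2 ^ 4 * Θ * x ^ 2 := hfin
      _ = _ := by rw [hx2]; ring
  calc ∫⁻ z, ∫⁻ ω, F (z, ω) ∂wienerPair ∂μ ≤ ∫⁻ q, G₁ q ∂π + ∫⁻ q, G₂ q ∂π := hsplit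
    _ ≤ ENNReal.ofReal (A₁ + A₂ * (4 * T)) + ENNReal.ofReal (4 * Real.sqrt (C₄ * (b + bY))) := add_le_add hT1 hT2
    _ ≤ _ := add_le_add (ENNReal.ofReal_le_ofReal hcone) le_rfl

end Estimate

end SeveredLocality

open SeveredLocality in
/-- **Registered helper `pinnedChain_openChain_severed_estimate`** (fixed-scale core of stub (M1sev)
`stub_openChainSeveredLocality`, line `series-law-at-every-laplace-frequency`): the mean square, under the stationary
law `μ_{N,T} ⊗ W` of the constructed Langevin flow of the open pinned anharmonic chain, of the central bond current along
the strong solution minus the same current along LLL's severed flow of the window `[k-M, k+1+M]` started from the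
embedded initial condition, at any time `t ≤ τ`, is at most
`(32(1+4β)² + 8T(1+12β)²)R⁸Θ/4^{2M+1} + 4√(C₄(b + 4^{16}C_pτ^{32}·4/ρ^{32}))` (`R² = 3ρ²√(3+M)`,
`Θ = ω₂ + 3 lam R² + 4(1+12βR²)`), given a scale `ρ ≥ 1` in the regime `2e√Θτ ≤ 2M+1`, an exceptional set of measure
`≤ b` off which the weighted position box of the strong solution holds on `[0, τ]`, and `∫ j_k⁴ dμ_{N,T} ≤ C₄`.
[folklore] -/
theorem pinnedChain_openChain_severed_estimate :
    ∀ ω₂ lam β γ : ℝ, 0 < ω₂ → 0 < lam → 0 < β → 0 < γ → ∀ T : ℝ, 0 < T →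
      ∀ (hB1 : (Literature.MathematicalPhysics.KineticTheory.HeatConduction.pinnedChain ω₂ lam β γ).CondB1) (N : ℕ)
        (e : Fin N ≃ ↥(Finset.Icc (0 : ℤ) (0 + N - 1))),
        (∀ k : Fin N, ((e k : ↥(Finset.Icc (0 : ℤ) (0 + N - 1))) : ℤ) = 0 + k) →
        ∀ (η₀ : Literature.MathematicalPhysics.KineticTheory.HeatConduction.ChainConfig) (k : Fin N) (M : ℕ),
          M + 2 ≤ k.val → k.val + M + 3 < N → ∀ (ρ τ : ℝ), 1 ≤ ρ → 0 < τ →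
          2 * Real.exp 1 * (Real.sqrt (ω₂ + 3 * lam * (3 * ρ ^ 2 * Real.sqrt (3 + (M : ℝ))) +
            4 * (1 + 12 * β * (3 * ρ ^ 2 * Real.sqrt (3 + (M : ℝ))))) * τ) ≤ 2 * M + 1 →
          ∀ (E : Set (Literature.MathematicalPhysics.KineticTheory.HeatConduction.PhaseSpace N ×
              Literature.Probability.Process.WienerPair)), MeasurableSet E → ∀ b : ℝ, 0 ≤ b →
          (((Literature.MathematicalPhysics.KineticTheory.HeatConduction.pinnedChain ω₂ lam β γ).gibbsMeasure N T).prod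
              Literature.Probability.Process.wienerPair) E ≤ ENNReal.ofReal b →
          (∀ q ∉ E, ∀ s ∈ Set.Icc (0:ℝ) τ, ∀ j j' : Fin N, ((j' : ℤ) - j).natAbs ≤ 1 →
            ((Literature.MathematicalPhysics.KineticTheory.HeatConduction.pinnedChain ω₂ lam β γ).solMap N T T s q.1
                (Literature.Probability.Process.pairPath q.2)).1 j' ^ 2 ≤
              ρ ^ 2 * Real.sqrt (1 + (((j : ℤ) - k).natAbs : ℝ))) →
          ∀ C₄ : ℝ, 0 ≤ C₄ →
          MeasureTheory.Integrable (fun x => (Literature.MathematicalPhysics.KineticTheory.HeatConduction.pinnedChain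
              ω₂ lam β γ).bondCurrent N k x ^ 4)
            ((Literature.MathematicalPhysics.KineticTheory.HeatConduction.pinnedChain ω₂ lam β γ).gibbsMeasure N T) →
          ∫ x, (Literature.MathematicalPhysics.KineticTheory.HeatConduction.pinnedChain ω₂ lam β γ).bondCurrent N k x ^ 4
              ∂((Literature.MathematicalPhysics.KineticTheory.HeatConduction.pinnedChain ω₂ lam β γ).gibbsMeasure N T) ≤ C₄ →
          ∀ t ∈ Set.Icc (0:ℝ) τ,
            ∫⁻ z, ∫⁻ ω, ENNReal.ofReal
                (((Literature.MathematicalPhysics.KineticTheory.HeatConduction.pinnedChain ω₂ lam β γ).bondCurrent N k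
                    ((Literature.MathematicalPhysics.KineticTheory.HeatConduction.pinnedChain ω₂ lam β γ).solMap N T T t z
                      (Literature.Probability.Process.pairPath ω)) -
                  (Literature.MathematicalPhysics.KineticTheory.HeatConduction.pinnedChain ω₂ lam β γ).bondCurrentZ
                    (Literature.MathematicalPhysics.KineticTheory.HeatConduction.OscillatorChain.severedFlow hB1
                      (Finset.Icc ((k.val : ℤ) - M) ((k.val : ℤ) + 1 + M)) t
                      (Literature.MathematicalPhysics.KineticTheory.HeatConduction.OscillatorChain.embed
                        (Finset.Icc (0 : ℤ) (0 + N - 1)) e η₀ z)) (k.val : ℤ)) ^ 2)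
                ∂Literature.Probability.Process.wienerPair
                ∂((Literature.MathematicalPhysics.KineticTheory.HeatConduction.pinnedChain ω₂ lam β γ).gibbsMeasure N T) ≤
              ENNReal.ofReal ((32 * (1 + 4 * β) ^ 2 + 8 * T * (1 + 12 * β) ^ 2) *
                  (3 * ρ ^ 2 * Real.sqrt (3 + (M : ℝ))) ^ 4 *
                  (ω₂ + 3 * lam * (3 * ρ ^ 2 * Real.sqrt (3 + (M : ℝ))) +
                    4 * (1 + 12 * β * (3 * ρ ^ 2 * Real.sqrt (3 + (M : ℝ))))) / 4 ^ (2 * M + 1)) +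
                ENNReal.ofReal (4 * Real.sqrt (C₄ * (b +
                  4 ^ 16 * (T ^ 16 * ∏ j ∈ Finset.range 16, (2 * (j : ℝ) + 1)) * τ ^ 32 / ρ ^ 32 * 4))) :=
  fun _ _ _ _ hω hl hβ hγ _ hT hB1 _ e he η₀ k _ hk hkN _ _ hρ hτ hreg E hEm _ hb hEπ hbox _ hC₄ hI hI4 _ ht =>
    severed_estimate hω hl hβ hγ hT hB1 e he η₀ k hk hkN hρ hτ hreg E hEm hb hEπ hbox hC₄ ⟨hI, hI4⟩ ht

end Summit.AtomisticToContinuum.FouriersLaw.Theorems.AbelThermodynamicLimit.SeriesLawAtEveryLaplaceFrequency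

end
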